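import Summits.QuantumFields.YangMills.Theorems.BalabanUVNodesN08HaarCompatibilityGuardReparam
import Summits.QuantumFields.YangMills.Theorems.BalabanUVNodesN08HaarCompatibilityGuardCrossingLaw

/-!
# BalabanUVNodes ∕ N08 — AT A FLAT BACKGROUND THE TYPED (0.4) AVERAGING IS THE `L^{1−d}`-POWER MAP OF THE PRIVATE COORDINATE:
# `Ū(c)(1[β(c) ↦ g]) = exp(L^{1−d} · log g)` on the guard `‖g − 1‖ < δ_N`, `= g` off it (printed exp-mean-log on `SU(N)`, every `N`)

WIDTH SEAT `pub-ymgap-dag-n08-w3` g3, plan `W-SEAT-START-LIST.md` v8 §n08 item 3 PART 11 (successor piece of part 8 p597554 `…GuardReparam`, inside the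
item's residue «E6′ proper ∕ road (iv) `Ψ_*(dU) = dU`»), 2026-08-28.  Track A, DAG node N08 = [Balaban1985UV3] Thm 1 p. 257 (compact) + Thm 2 p. 272;
key item K1⁷ `StabilityBAtRecordR13SepCoPH` (stmt-QuantumFields-20542), `--supports … --as helper`.  COUNT-NEUTRAL.

THE POINT.  Part 8 put the typed (0.4) averaging in the normal form `Ū = axial ∘ Ψ` (`Ψ` left-multiplies each central crossing coordinate `U(β(c))`
by the conjugated correction `pre⁻¹ · corr · pre`) and recorded the SUFFICIENT condition `Ψ_*(dU) = dU ⇒ E6′`, a statement about the ONE-VARIABLE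
fibre maps `g ↦ (Ψ U[β(c) ↦ g])(β(c))`.  This file computes that fibre map EXACTLY at the flat background `U = 1`: by `BlockAveragingHaarAC` FACT (B)
the central (on-axis) loop variables of `c` backtrack (`= 1`) and the non-central ones are `V_i · U(c)⁻¹` with `V_i = 1` at the flat background, so the
loop family of `c` at `1[β(c) ↦ g]` is `(1,…,1, g⁻¹,…,g⁻¹)` (`loopHol_update_one`), the guard reads `dist1 g < δ` (`small_update_one_iff`), and for the
PRINTED exp-mean-log on `SU(N)` the correction is `exp(−(1 − λ) log g)`, `λ = N_c ∕ #Idx = L^{1−d}` (`nCentral_mul_pow`), whence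
`Ū(c) = exp(−(1−λ) log g) · exp(log g) = exp(λ log g)` (`coe_avgFun_update_one`): ON THE GUARD THE (0.4) AVERAGING CONTRACTS THE PRIVATE COORDINATE BY
`L^{1−d}` IN THE LIE ALGEBRA (its (0.8) linearisation, EXACT at the flat background) and is the identity off it; in particular it maps the guard ball
`{dist1 < δ_N}` INTO the ball `{dist1 ≤ e^{2δ_N∕3} − 1}`, and `e^{2δ_N∕3} − 1 < δ_N` (`dist1_avgFun_update_one_le`, `rho_lt_deltaSU`).  The sequel
`…GuardFlatFibre` (part 11B) draws the measure-theoretic consequence (the flat fibre law is NOT Haar), part 12 refutes `Ψ_*(dU) = dU` itself.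

WHAT THIS FILE PROVES ([folklore] over landed modules; nothing of Bałaban's asserted; 0 `def`).  §1 (any group, any small-loop average, in range):
`loopHol_update_one`, ★ `small_update_one_iff` (`d ≥ 2`), `avgFun_update_one_of_small`, `reparam_update_one_apply`
(the `β(c)`-output of part 8's `Ψ` at `1[β(c) ↦ g]` IS `Ū(c)` there).  §2 (counting) ★ `nCentral_mul_pow` (`N_c · L^{d−1} = #Idx`), `nCentral_div_card`,
`nCentral_div_card_le_third`.  §3 (`SU(N)`, `ℰ = expMeanLogSU`, every `N`) `coe_avg_flat`, ★★ `coe_avgFun_update_one` (`= exp((N_c∕#Idx) • mlog g)` on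
`‖g − 1‖ < δ_N`), `coe_avgFun_update_one'` (`= exp((L^{d−1})⁻¹ • mlog g)`), `avgFun_update_one_of_le`, ★ `dist1_avgFun_update_one_le` (`≤ exp(2δ_N∕3) − 1`),
`rho_lt_deltaSU`.  §4 at the [B10] slot `avOfPrint N S j` (`d = 3`): ★ `coe_avOfPrint_update_one` (exponent `1∕L²`), `avOfPrint_update_one_of_le`.

HONEST FRAMING.  A kernel computation about the typed (0.4) averaging at ONE background; it decides neither E6′ nor `Ψ_*(dU) = dU`; count-neutral; N08 NOT
discharged; counts unmoved (typed 28∕28 · discharged 5∕27); one finite 𝕋⁴ programme at fixed ε — R4 closes the CONDITIONAL rung `BalabanLadder.UV` only;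
the Yang–Mills mass gap (Clay) is NOT proved by any of this; nothing continuum ∕ ℝ³ ∕ ℝ⁴ ∕ OS ∕ mass gap.  0 `sorry`, 0 `def`, 0 `instance`, standard axioms.
-/
noncomputable section

open MeasureTheory Function NormedSpace

namespace Summit.QuantumFields.YangMills.BalabanUVNodes.N08HaarCompatibilityGuardPowerMap

open Literature.MathematicalPhysics.QuantumFieldTheory.Balaban1983to89
open Literature.MathematicalPhysics.QuantumFieldTheory.Balaban1983to89.T4Continuum
open Literature.MathematicalPhysics.QuantumFieldTheory.Balaban1983to89.AveragingRT (axialAvg two_mul_half_add_one)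
open Literature.MathematicalPhysics.QuantumFieldTheory.Balaban1983to89.BlockAveraging
  (Idx off loopHol Small corr avgFun measurable_avgFun)
open Literature.MathematicalPhysics.QuantumFieldTheory.Balaban1983to89.BlockAveragingHaarAC
  (centralBond centralBond_injective openHol IsCentral nCentral nCentral_pos pre post loopHol_eq_openHol_mul openHol_of_isCentral
    openHol_update_of_not_isCentral axialAvg_update_centralBond pre_update post_update avgFun_of_not_small)
open Summit.QuantumFields.YangMills.BalabanUVNodes.N09OneDefectAveraging
  (exists_not_isCentral pre_one post_one openHol_one axialAvg_update_one_self loopHol_update_one_self_of_not_isCentral not_small_update_one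
    avgFun_update_one_self)
open Summit.QuantumFields.YangMills.BalabanUVNodes.N08HaarCompatibilityGuardReparam (extend_centralBond_apply)
open Summit.QuantumFields.YangMills.BalabanUVNodes.N08HaarCompatibilityGuardCrossingLaw (off_eq_zero_iff)

/-! ## §1. One private coordinate on the flat background: the loop family of `c` at `1[β(c) ↦ g]` -/

section Flat

variable {P : Params} {j : ℕ} {G : Type*} [GaugeGroup G]

/-- At a CENTRAL index the open holonomy at `1[β(c) ↦ g]` is `g` (FACT (B): `V_i = U(c)`, and `U(c) = g` there, n09's `axialAvg_update_one_self`).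
[cite: Balaban1987RG1, (0.4) p.253 (bookkeeping)] -/
theorem openHol_update_one_of_isCentral (hj : j + 1 ≤ P.m + P.K) {c : PBond P (j + 1)} {i : Idx P} (h : IsCentral c i) (g : G) :
    openHol (update (1 : GaugeField P j G) (centralBond c) g) c i = g := by
  rw [openHol_of_isCentral _ c i h, axialAvg_update_one_self hj]

/-- At a NON-CENTRAL index the open holonomy at `1[β(c) ↦ g]` is `1` (FACT (A): `V_i` does not see `U(β(c))`). [cite: Balaban1987RG1, (0.4) p.253 (bookkeeping)] -/
theorem openHol_update_one_of_not_isCentral (hj : j + 1 ≤ P.m + P.K) {c : PBond P (j + 1)} {i : Idx P} (h : ¬ IsCentral c i) (g : G) :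
    openHol (update (1 : GaugeField P j G) (centralBond c) g) c i = 1 := by
  rw [openHol_update_of_not_isCentral hj 1 c i h g, openHol_one]

/-- **THE LOOP FAMILY OF `c` AT `1[β(c) ↦ g]` IS `(1 on the axis, g⁻¹ off it)`**: central loops backtrack (`V_i · U(c)⁻¹ = g · g⁻¹`), non-central ones are
`V_i · U(c)⁻¹ = g⁻¹` (n09's `loopHol_update_one_self_of_not_isCentral`). [cite: Balaban1987RG1, (0.4) p.253 (the loop variables `U(Γ ∪ [x,x′] ∪ (−Γ′) ∪ (−c))`; bookkeeping)] -/
theorem loopHol_update_one (hj : j + 1 ≤ P.m + P.K) (c : PBond P (j + 1)) (g : G) (i : Idx P) :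
    loopHol (update (1 : GaugeField P j G) (centralBond c) g) c i = if IsCentral c i then 1 else g⁻¹ := by
  split_ifs with h
  · rw [loopHol_eq_openHol_mul, axialAvg_update_one_self hj, openHol_update_one_of_isCentral hj h, mul_inv_cancel]
  · exact loopHol_update_one_self_of_not_isCentral hj c g h

/-- … as a family. [cite: Balaban1987RG1, (0.4) p.253 (bookkeeping)] -/
theorem loopHol_update_one_eq (hj : j + 1 ≤ P.m + P.K) (c : PBond P (j + 1)) (g : G) :
    loopHol (update (1 : GaugeField P j G) (centralBond c) g) c = fun i => if IsCentral c i then 1 else g⁻¹ :=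
  funext (loopHol_update_one hj c g)

variable (ℰ : LoopAverage G)

/-- **THE GUARD AT `1[β(c) ↦ g]` READS `dist1 g < δ`** (`d ≥ 2`, so that a non-central index exists; `dist1` is inversion invariant; n09's `not_small_update_one`
is the `←` half). [cite: Balaban1987RG1, (0.4) p.253 («for a set {U_j} of elements close to the identity»; bookkeeping)] -/
theorem small_update_one_iff (hj : j + 1 ≤ P.m + P.K) (hd : 2 ≤ P.d) (c : PBond P (j + 1)) (g : G) :
    Small ℰ (update (1 : GaugeField P j G) (centralBond c) g) c ↔ dist1 g < ℰ.δ := by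
  refine ⟨fun h => not_le.1 fun hg => not_small_update_one hj hd ℰ c hg h, fun hg i => ?_⟩
  rw [loopHol_update_one hj]
  split_ifs
  · rw [GaugeGroup.dist1_one]; exact ℰ.δ_pos
  · rwa [GaugeGroup.dist1_inv]

/-- **ON THE GUARD `Ū(c)(1[β(c) ↦ g]) = ℰ(1,…,1,g⁻¹,…,g⁻¹) · g`** (off it `= g`, n09's `avgFun_update_one_self`). [cite: Balaban1987RG1, (0.4) p.253 (bookkeeping)] -/
theorem avgFun_update_one_of_small (hj : j + 1 ≤ P.m + P.K) (hd : 2 ≤ P.d) (c : PBond P (j + 1)) {g : G} (hg : dist1 g < ℰ.δ) :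
    avgFun ℰ (update (1 : GaugeField P j G) (centralBond c) g) c = ℰ.avg (fun i : Idx P => if IsCentral c i then (1 : G) else g⁻¹) * g := by
  show corr ℰ _ c * axialAvg _ c = _
  unfold corr
  rw [if_pos ((small_update_one_iff ℰ hj hd c g).2 hg), loopHol_update_one_eq hj, axialAvg_update_one_self hj]

/-- **THE `β(c)`-OUTPUT OF PART 8's `Ψ` AT `1[β(c) ↦ g]` IS `Ū(c)` THERE** (`pre = 1` at the flat background): the flat fibre map of `Ψ` at `c` is
`g ↦ Ū(c)(1[β(c) ↦ g])`. [cite: Balaban1987RG1, (0.4) p.253 (bookkeeping)] -/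
theorem reparam_update_one_apply (hj : j + 1 ≤ P.m + P.K) (c : PBond P (j + 1)) (g : G) :
    (fun b => Function.extend centralBond
        (fun c' => (pre (update (1 : GaugeField P j G) (centralBond c) g) c')⁻¹ * corr ℰ (update (1 : GaugeField P j G) (centralBond c) g) c' *
          pre (update (1 : GaugeField P j G) (centralBond c) g) c') (fun _ => (1 : G)) b * update (1 : GaugeField P j G) (centralBond c) g b)
        (centralBond c) =
      avgFun ℰ (update (1 : GaugeField P j G) (centralBond c) g) c := by
  show _ * _ = corr ℰ _ c * axialAvg _ c
  rw [extend_centralBond_apply hj, pre_update hj, pre_one, inv_one, one_mul, mul_one, update_self, axialAvg_update_one_self hj]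

end Flat

/-! ## §2. Counting: `N_c · L^{d−1} = #Idx`, i.e. `λ = N_c ∕ #Idx = L^{1−d}` -/

section Count

variable {P : Params} {j : ℕ}

/-- The central labels `{r | r_ν = (L−1)∕2 for ν ≠ μ}` are parametrised by the longitudinal label `r_μ ∈ Fin L`. [folklore] -/
theorem card_central_labels (c : PBond P (j + 1)) :
    Fintype.card {r : Fin P.d → Fin P.L // ∀ ν, ν ≠ c.dir → off r ν = 0} = P.L := by
  classical
  have hL := two_mul_half_add_one P
  set m₀ : Fin P.L := ⟨(P.L - 1) / 2, by omega⟩ with hm₀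
  have e : {r : Fin P.d → Fin P.L // ∀ ν, ν ≠ c.dir → off r ν = 0} ≃ Fin P.L :=
    { toFun := fun r => r.1 c.dir
      invFun := fun t => ⟨fun ν => if ν = c.dir then t else m₀, fun ν hν => by
        rw [off_eq_zero_iff, if_neg hν]⟩
      left_inv := fun r => by
        apply Subtype.ext
        funext ν
        show (if ν = c.dir then r.1 c.dir else m₀) = r.1 ν
        by_cases h : ν = c.dir
        · rw [if_pos h, h]
        · rw [if_neg h]; exact ((off_eq_zero_iff r.1 ν).1 (r.2 ν h)).symm
      right_inv := fun t => by
        show (if c.dir = c.dir then t else m₀) = t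
        rw [if_pos rfl] }
  rw [Fintype.card_congr e, Fintype.card_fin]

/-- The number of central indices is `L · (d!)²` (central labels times the two orderings). [folklore] -/
theorem nCentral_eq (c : PBond P (j + 1)) :
    nCentral c = P.L * Fintype.card (Equiv.Perm (Fin P.d) × Equiv.Perm (Fin P.d)) := by
  classical
  unfold nCentral
  rw [← Fintype.card_subtype]
  have e : {i : Idx P // IsCentral c i} ≃
      {r : Fin P.d → Fin P.L // ∀ ν, ν ≠ c.dir → off r ν = 0} × (Equiv.Perm (Fin P.d) × Equiv.Perm (Fin P.d)) :=
    Equiv.prodSubtypeFstEquivSubtypeProd (α := Fin P.d → Fin P.L) (β := Equiv.Perm (Fin P.d) × Equiv.Perm (Fin P.d))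
      (p := fun r => ∀ ν, ν ≠ c.dir → off r ν = 0)
  rw [Fintype.card_congr e, Fintype.card_prod, card_central_labels]

/-- **`N_c · L^{d−1} = #Idx`**: the fraction of central indices is `L^{1−d}` — the exponent of the power map of §3.
[cite: Balaban1987RG1, (0.4) p.253 (the weights `L^{-d}|G(c₋,x)|⁻¹|G(c₊,x′)|⁻¹`; bookkeeping)] -/
theorem nCentral_mul_pow (c : PBond P (j + 1)) : nCentral c * P.L ^ (P.d - 1) = Fintype.card (Idx P) := by
  have hpow : P.L ^ P.d = P.L ^ (P.d - 1) * P.L := by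
    rw [← pow_succ, Nat.sub_add_cancel P.hd]
  have hidx : Fintype.card (Idx P) = P.L ^ P.d * Fintype.card (Equiv.Perm (Fin P.d) × Equiv.Perm (Fin P.d)) := by
    rw [show Fintype.card (Idx P) = Fintype.card ((Fin P.d → Fin P.L) × (Equiv.Perm (Fin P.d) × Equiv.Perm (Fin P.d))) from rfl,
      Fintype.card_prod, Fintype.card_fun, Fintype.card_fin, Fintype.card_fin]
  rw [nCentral_eq, hidx, hpow]
  ring

/-- `N_c ≤ #Idx`. [folklore] -/
theorem nCentral_le_card (c : PBond P (j + 1)) : nCentral c ≤ Fintype.card (Idx P) :=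
  (Finset.card_filter_le _ _).trans Finset.card_univ.le

/-- **`λ = N_c ∕ #Idx = (L^{d−1})⁻¹`** (as a complex number, the scalar of §3). [folklore] -/
theorem nCentral_div_card (c : PBond P (j + 1)) :
    (nCentral c : ℂ) / (Fintype.card (Idx P) : ℂ) = (((P.L : ℂ) ^ (P.d - 1)))⁻¹ := by
  have hL : (P.L : ℂ) ≠ 0 := Nat.cast_ne_zero.2 (by have := P.hL.2; omega)
  have hN : (nCentral c : ℂ) ≠ 0 := Nat.cast_ne_zero.2 (nCentral_pos c).ne'
  rw [← nCentral_mul_pow c, Nat.cast_mul, Nat.cast_pow, div_mul_eq_div_div, div_self hN, one_div]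

/-- `λ = N_c ∕ #Idx = (L^{d−1})⁻¹` as a real number. [folklore] -/
theorem nCentral_div_card_real (c : PBond P (j + 1)) :
    (nCentral c : ℝ) / (Fintype.card (Idx P) : ℝ) = (((P.L : ℝ) ^ (P.d - 1)))⁻¹ := by
  have hN : (nCentral c : ℝ) ≠ 0 := Nat.cast_ne_zero.2 (nCentral_pos c).ne'
  rw [← nCentral_mul_pow c, Nat.cast_mul, Nat.cast_pow, div_mul_eq_div_div, div_self hN, one_div]

/-- `λ ≤ 1∕3` when `d ≥ 2` (`L` odd `> 1`, so `L ≥ 3`). [folklore] -/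
theorem nCentral_div_card_le_third (hd : 2 ≤ P.d) (c : PBond P (j + 1)) :
    (nCentral c : ℝ) / (Fintype.card (Idx P) : ℝ) ≤ 1 / 3 := by
  rw [nCentral_div_card_real, one_div]
  have hL3 : (3 : ℝ) ≤ P.L := by
    obtain ⟨k, hk⟩ := P.hL.1
    have := P.hL.2
    exact_mod_cast (show 3 ≤ P.L by omega)
  refine inv_anti₀ (by norm_num) ?_
  calc (3 : ℝ) ≤ P.L := hL3
    _ = (P.L : ℝ) ^ 1 := (pow_one _).symm
    _ ≤ (P.L : ℝ) ^ (P.d - 1) := pow_le_pow_right₀ (by linarith) (by omega)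

/-- `0 ≤ λ`. [folklore] -/
theorem nCentral_div_card_nonneg (c : PBond P (j + 1)) : 0 ≤ (nCentral c : ℝ) / (Fintype.card (Idx P) : ℝ) :=
  div_nonneg (Nat.cast_nonneg _) (Nat.cast_nonneg _)

end Count

/-! ## §3. `SU(N)` with the printed exp-mean-log: `Ū(c)(1[β(c) ↦ g]) = exp(λ · log g)`, the `L^{1−d}`-power map -/

section SUN

open scoped Matrix.Norms.L2Operator
open ExpMeanLog (expMeanLogSU expMeanLogSU_δ deltaSU deltaSU_pos lt_third_of_lt_deltaSU coe_ESU_of_small ESU eml eml_eq_exp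
  mlog_eq_neg_of_mul_eq_one norm_star_sub_one measurable_expMeanLogSU_E)
open MatrixLog (mlog mlog_one exp_mlog norm_mlog_le_two_mul)
open Literature.MathematicalPhysics.QuantumFieldTheory.Balaban1983to89.Node00 (SU)

variable (N : ℕ) [NeZero N] {P : Params} {j : ℕ}

/-- In the model `dist1 g = ‖g − 1‖` (operator norm), so the guard radius of `expMeanLogSU` is `δ_N = min(1∕3, π∕N)` (plumbing). [folklore] -/
theorem dist1_eq_norm (g : SU N) : dist1 g = ‖(g : Matrix (Fin N) (Fin N) ℂ) - 1‖ := rfl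

/-- `(expMeanLogSU : LoopAverage (SU N)).δ = δ_N` (plumbing). [folklore] -/
theorem delta_eq : (expMeanLogSU : LoopAverage (SU N)).δ = deltaSU (Fin N) := rfl

/-- **THE EXP-MEAN-LOG OF THE FLAT LOOP FAMILY `(1,…,1,g⁻¹,…,g⁻¹)` IS `exp(−(1 − λ) · log g)`**, `1 − λ = (#Idx − N_c)∕#Idx` (series = principal
logarithm on the guard; `log g⁻¹ = −log g`, `log 1 = 0`). [cite: Balaban1987RG1, (0.4) p.253 (the printed `exp[i Σ |I|⁻¹ (1/i) log W_i]`; bookkeeping)] -/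
theorem coe_avg_flat (c : PBond P (j + 1)) (g : SU N) (hg : dist1 g < deltaSU (Fin N)) :
    ((((expMeanLogSU : LoopAverage (SU N)).avg fun i : Idx P => if IsCentral c i then (1 : SU N) else g⁻¹) : SU N) :
        Matrix (Fin N) (Fin N) ℂ) =
      exp (-((((Fintype.card (Idx P) - nCentral c : ℕ) : ℂ) / (Fintype.card (Idx P) : ℂ)) • mlog (g : Matrix (Fin N) (Fin N) ℂ))) := by
  classical
  set W : Idx P → SU N := fun i => if IsCentral c i then (1 : SU N) else g⁻¹ with hW
  have hgU : (g : Matrix (Fin N) (Fin N) ℂ) ∈ Matrix.unitaryGroup (Fin N) ℂ := (Matrix.mem_specialUnitaryGroup_iff.1 g.2).1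
  have hinv : (((g⁻¹ : SU N)) : Matrix (Fin N) (Fin N) ℂ) = star (g : Matrix (Fin N) (Fin N) ℂ) := rfl
  have hsmallW : ∀ i, ‖((W i : SU N) : Matrix (Fin N) (Fin N) ℂ) - 1‖ < deltaSU (Fin N) := by
    intro i
    simp only [hW]
    split_ifs
    · rw [OneMemClass.coe_one, sub_self, norm_zero]; exact deltaSU_pos
    · rw [hinv, norm_star_sub_one]; exact hg
  have hsmall : ∀ i, ‖(((W ∘ (LoopAverage.enum (Idx P)).symm) i : SU N) : Matrix (Fin N) (Fin N) ℂ) - 1‖ < deltaSU (Fin N) :=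
    fun i => hsmallW _
  show (((ESU (W ∘ (LoopAverage.enum (Idx P)).symm) : SU N)) : Matrix (Fin N) (Fin N) ℂ) = _
  rw [coe_ESU_of_small hsmall, eml_eq_exp]
  congr 1
  -- the exponent
  have hcard : (Fintype.card (Fin (Fintype.card (Idx P) - 1 + 1)) : ℂ) = Fintype.card (Idx P) := by
    rw [Fintype.card_fin, Nat.sub_add_cancel Fintype.card_pos]
  have hsum : ∑ i : Fin (Fintype.card (Idx P) - 1 + 1), mlog ((((W ∘ (LoopAverage.enum (Idx P)).symm) i : SU N)) : Matrix (Fin N) (Fin N) ℂ) =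
      ∑ k : Idx P, mlog (((W k : SU N)) : Matrix (Fin N) (Fin N) ℂ) :=
    Equiv.sum_comp (LoopAverage.enum (Idx P)).symm (fun k => mlog (((W k : SU N)) : Matrix (Fin N) (Fin N) ℂ))
  have hlog : mlog (star (g : Matrix (Fin N) (Fin N) ℂ)) = -mlog (g : Matrix (Fin N) (Fin N) ℂ) :=
    mlog_eq_neg_of_mul_eq_one (Unitary.mul_star_self_of_mem hgU) (lt_third_of_lt_deltaSU hg).le
  have hterm : ∀ k : Idx P, mlog (((W k : SU N)) : Matrix (Fin N) (Fin N) ℂ) =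
      if IsCentral c k then 0 else -mlog (g : Matrix (Fin N) (Fin N) ℂ) := by
    intro k
    simp only [hW]
    split_ifs
    · rw [OneMemClass.coe_one, mlog_one]
    · rw [hinv, hlog]
  have hn : Fintype.card (Idx P) - nCentral c = (Finset.univ.filter fun k => ¬ IsCentral c k).card := by
    unfold nCentral
    have h := Finset.card_filter_add_card_filter_not (s := (Finset.univ : Finset (Idx P))) (IsCentral c)
    rw [Finset.card_univ] at h
    omega
  rw [hcard, hsum, Finset.sum_congr rfl fun k _ => hterm k, Finset.sum_ite, Finset.sum_const_zero, zero_add, Finset.sum_const,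
    ← Nat.cast_smul_eq_nsmul ℂ, smul_smul, smul_neg, hn, inv_mul_eq_div]

/-- **THE POWER MAP**: on the guard `‖g − 1‖ < δ_N`, the typed (0.4) averaging of `c` at the flat background with private coordinate `g` is
`Ū(c)(1[β(c) ↦ g]) = exp(λ · log g)`, `λ = N_c ∕ #Idx` — the correction `exp(−(1−λ) log g)` times `g = exp(log g)`, two commuting exponentials
(standing range, `d ≥ 2`, every `N`). [cite: Balaban1987RG1, (0.4) and (0.8) p.253 (the printed exp-mean-log; its linearisation is exact here; bookkeeping)] -/
theorem coe_avgFun_update_one (hj : j + 1 ≤ P.m + P.K) (hd : 2 ≤ P.d) (c : PBond P (j + 1)) (g : SU N)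
    (hg : dist1 g < deltaSU (Fin N)) :
    ((avgFun (expMeanLogSU : LoopAverage (SU N)) (update (1 : GaugeField P j (SU N)) (centralBond c) g) c : SU N) : Matrix (Fin N) (Fin N) ℂ) =
      exp (((nCentral c : ℂ) / (Fintype.card (Idx P) : ℂ)) • mlog (g : Matrix (Fin N) (Fin N) ℂ)) := by
  letI : NormedAlgebra ℚ (Matrix (Fin N) (Fin N) ℂ) := NormedAlgebra.restrictScalars ℚ ℂ _
  have hg1 : ‖(g : Matrix (Fin N) (Fin N) ℂ) - 1‖ < 1 := (lt_third_of_lt_deltaSU hg).trans (by norm_num)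
  have hcard : (Fintype.card (Idx P) : ℂ) ≠ 0 := Nat.cast_ne_zero.2 Fintype.card_pos.ne'
  rw [avgFun_update_one_of_small (expMeanLogSU : LoopAverage (SU N)) hj hd c (by rw [delta_eq]; exact hg), Submonoid.coe_mul, coe_avg_flat N c g hg]
  set X : Matrix (Fin N) (Fin N) ℂ := mlog (g : Matrix (Fin N) (Fin N) ℂ) with hX
  have hgX : (g : Matrix (Fin N) (Fin N) ℂ) = exp X := (exp_mlog hg1).symm
  rw [hgX, ← exp_add_of_commute (((Commute.refl X).smul_left _).neg_left)]
  congr 1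
  rw [show -((((Fintype.card (Idx P) - nCentral c : ℕ) : ℂ) / (Fintype.card (Idx P) : ℂ)) • X) + X =
      (-(((Fintype.card (Idx P) - nCentral c : ℕ) : ℂ) / (Fintype.card (Idx P) : ℂ)) + 1) • X by rw [add_smul, neg_smul, one_smul]]
  congr 1
  rw [Nat.cast_sub (nCentral_le_card c), sub_div, div_self hcard]
  ring

/-- **THE POWER MAP, EXPONENT `L^{1−d}`**: `Ū(c)(1[β(c) ↦ g]) = exp((L^{d−1})⁻¹ · log g)` on the guard. [cite: Balaban1987RG1, (0.4) and (0.8) p.253 (bookkeeping)] -/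
theorem coe_avgFun_update_one' (hj : j + 1 ≤ P.m + P.K) (hd : 2 ≤ P.d) (c : PBond P (j + 1)) (g : SU N)
    (hg : dist1 g < deltaSU (Fin N)) :
    ((avgFun (expMeanLogSU : LoopAverage (SU N)) (update (1 : GaugeField P j (SU N)) (centralBond c) g) c : SU N) : Matrix (Fin N) (Fin N) ℂ) =
      exp ((((P.L : ℂ) ^ (P.d - 1)))⁻¹ • mlog (g : Matrix (Fin N) (Fin N) ℂ)) := by
  rw [coe_avgFun_update_one N hj hd c g hg, nCentral_div_card]

/-- **OFF THE GUARD THE FIBRE MAP IS THE IDENTITY** on `SU(N)`: `Ū(c)(1[β(c) ↦ g]) = g` for `‖g − 1‖ ≥ δ_N`. [cite: Balaban1987RG1, (0.4) p.253 (bookkeeping)] -/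
theorem avgFun_update_one_of_le (hj : j + 1 ≤ P.m + P.K) (hd : 2 ≤ P.d) (c : PBond P (j + 1)) (g : SU N)
    (hg : deltaSU (Fin N) ≤ dist1 g) :
    avgFun (expMeanLogSU : LoopAverage (SU N)) (update (1 : GaugeField P j (SU N)) (centralBond c) g) c = g :=
  avgFun_update_one_self hj hd _ c (by rw [delta_eq]; exact hg)

/-- **THE CONTRACTION**: on the guard, `dist1 Ū(c)(1[β(c) ↦ g]) ≤ exp(λ · 2‖g − 1‖) − 1 ≤ exp(2δ_N∕3) − 1` (`‖exp Y − 1‖ ≤ e^{‖Y‖} − 1`,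
`‖log g‖ ≤ 2‖g − 1‖`, `λ ≤ 1∕3`). [cite: Balaban1985Averaging, (26)–(27) p.22; Balaban1987RG1, (0.4) p.253 (bookkeeping)] -/
theorem dist1_avgFun_update_one_le (hj : j + 1 ≤ P.m + P.K) (hd : 2 ≤ P.d) (c : PBond P (j + 1)) (g : SU N)
    (hg : dist1 g < deltaSU (Fin N)) :
    dist1 (avgFun (expMeanLogSU : LoopAverage (SU N)) (update (1 : GaugeField P j (SU N)) (centralBond c) g) c) ≤
      Real.exp (2 * deltaSU (Fin N) / 3) - 1 := by
  letI : NormedAlgebra ℚ (Matrix (Fin N) (Fin N) ℂ) := NormedAlgebra.restrictScalars ℚ ℂ _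
  have hthird := lt_third_of_lt_deltaSU hg
  have hlog : ‖mlog (g : Matrix (Fin N) (Fin N) ℂ)‖ ≤ 2 * ‖(g : Matrix (Fin N) (Fin N) ℂ) - 1‖ :=
    norm_mlog_le_two_mul (hthird.le.trans (by norm_num))
  have hlam := nCentral_div_card_le_third hd c
  have hlam0 := nCentral_div_card_nonneg (P := P) c
  rw [dist1_eq_norm, coe_avgFun_update_one N hj hd c g hg]
  refine (Literature.Analysis.Calculus.norm_exp_sub_one_le _).trans (sub_le_sub_right (Real.exp_le_exp.2 ?_) 1)
  rw [norm_smul, show ((nCentral c : ℂ) / (Fintype.card (Idx P) : ℂ)) = (((nCentral c : ℝ) / (Fintype.card (Idx P) : ℝ) : ℝ) : ℂ) by push_cast; rfl,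
    Complex.norm_real, Real.norm_of_nonneg hlam0]
  have hd1 : dist1 g = ‖(g : Matrix (Fin N) (Fin N) ℂ) - 1‖ := rfl
  calc (nCentral c : ℝ) / Fintype.card (Idx P) * ‖mlog (g : Matrix (Fin N) (Fin N) ℂ)‖
      ≤ 1 / 3 * (2 * ‖(g : Matrix (Fin N) (Fin N) ℂ) - 1‖) := mul_le_mul hlam hlog (norm_nonneg _) (by norm_num)
    _ ≤ 1 / 3 * (2 * deltaSU (Fin N)) := by rw [← hd1]; nlinarith [hg.le]
    _ = 2 * deltaSU (Fin N) / 3 := by ring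

/-- `exp(2δ∕3) − 1 < δ` for `0 < δ ≤ 1∕3` (`e^x ≤ 1 + x + x²` on `|x| ≤ 1`). [folklore] -/
theorem exp_two_mul_div_three_sub_one_lt {δ : ℝ} (h0 : 0 < δ) (h1 : δ ≤ 1 / 3) : Real.exp (2 * δ / 3) - 1 < δ := by
  have hx : |2 * δ / 3| ≤ 1 := by rw [abs_of_nonneg (by positivity)]; linarith
  have h := Real.abs_exp_sub_one_sub_id_le hx
  have h' : Real.exp (2 * δ / 3) - 1 - 2 * δ / 3 ≤ (2 * δ / 3) ^ 2 := (le_abs_self _).trans h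
  nlinarith

/-- At the slot's radius: `exp(2δ_N∕3) − 1 < δ_N`. [folklore] -/
theorem rho_lt_deltaSU : Real.exp (2 * deltaSU (Fin N) / 3) - 1 < deltaSU (Fin N) :=
  exp_two_mul_div_three_sub_one_lt deltaSU_pos (min_le_left _ _)

end SUN

/-! ## §4. At the [B10] slot's averaging `avOfPrint N S j` (`d = 3`: the `1∕L²`-power map) -/

section Slot

open scoped Matrix.Norms.L2Operator
open Literature.MathematicalPhysics.QuantumFieldTheory.Balaban1985CMP102.Setting (Scales)
open Literature.MathematicalPhysics.QuantumFieldTheory.Balaban1983to89.B10RunsOfRecord (avOfPrint)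
open ExpMeanLog (expMeanLogSU deltaSU)
open MatrixLog (mlog)
open Literature.MathematicalPhysics.QuantumFieldTheory.Balaban1983to89.Node00 (SU)
open Summit.QuantumFields.YangMills.BalabanUVNodes.N08HaarCompatibilityGuard (avOfPrint_avg_of_le)

variable (N : ℕ) [NeZero N] {L : ℕ}

/-- **AT THE SLOT: print's averaging of record at the flat background is the `1∕L²`-power map of the private coordinate** (`d = 3`):
`(avOfPrint N S j).avg (1[β(c) ↦ g]) c = exp(L⁻² · log g)` for `‖g − 1‖ < min(1∕3, π∕N)`, every `N`, in range.
[cite: Balaban1985UV3, (2) p.256; Balaban1987RG1, (0.4) p.253 (bookkeeping)] -/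
theorem coe_avOfPrint_update_one (S : Scales L) {j : ℕ} (hj : j + 1 ≤ S.P.m + S.P.K) (c : PBond S.P (j + 1))
    (g : SU N) (hg : dist1 g < deltaSU (Fin N)) :
    (((avOfPrint N S j).avg (update (1 : GaugeField S.P j (SU N)) (centralBond c) g) c : SU N) : Matrix (Fin N) (Fin N) ℂ) =
      exp ((((L : ℂ) ^ 2))⁻¹ • mlog (g : Matrix (Fin N) (Fin N) ℂ)) := by
  rw [avOfPrint_avg_of_le N S hj, coe_avgFun_update_one' N hj (show 2 ≤ S.P.d from by show 2 ≤ 3; norm_num) c g hg]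
  rfl

/-- **AT THE SLOT: off the guard the flat fibre map is the identity.** [cite: Balaban1985UV3, (2) p.256; Balaban1987RG1, (0.4) p.253 (bookkeeping)] -/
theorem avOfPrint_update_one_of_le (S : Scales L) {j : ℕ} (hj : j + 1 ≤ S.P.m + S.P.K) (c : PBond S.P (j + 1))
    (g : SU N) (hg : deltaSU (Fin N) ≤ dist1 g) :
    (avOfPrint N S j).avg (update (1 : GaugeField S.P j (SU N)) (centralBond c) g) c = g := by
  rw [avOfPrint_avg_of_le N S hj]
  exact avgFun_update_one_of_le N hj (show 2 ≤ S.P.d from by show 2 ≤ 3; norm_num) c g hg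

end Slot

end Summit.QuantumFields.YangMills.BalabanUVNodes.N08HaarCompatibilityGuardPowerMap

end
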